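import Literature.Topology.FourManifolds.HomotopySpheresBPOrderSignatureLeaves
import Literature.Topology.FourManifolds.ClosedModelOrientation
import Literature.AlgebraicTopology.SingularHomology.IteratedSuspensionIsomorphism
import Literature.AlgebraicTopology.SingularHomology.TubeCollapseCohomology
import Literature.AlgebraicTopology.SingularHomology.CohomologyRingChange
import Literature.AlgebraicTopology.SingularHomology.OrientationProofs
import Literature.AlgebraicTopology.SingularHomology.UniversalCoefficientsField
import Literature.AlgebraicTopology.SingularHomology.CollapseMap
import Literature.AlgebraicTopology.SingularHomology.ExcisionMayerVietorisProofs
import Literature.AlgebraicTopology.SingularHomology.SphereHomology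
import HarnessLib

/-!
# The intersection form of a framed-tubed manifold bounded by a homotopy sphere is even

Kosinski, *Differential Manifolds* (1993), Ch. X, Prop. (3.1), p. 205 (evenness half): the
intersection form of a `4m`-dimensional `π`-manifold bounded by a homotopy sphere is even. This
file proves the statement of the tree's named fact
`Literature.Topology.FourManifolds.HomotopySphere.isEven_intersectionForm_closedModel`
(`HomotopySpheresBPOrderSignatureLeaves.lean`) from two geometric inputs, by the route of the Wu
class (Milnor–Stasheff, *Characteristic classes* (1974), §18 with Thm. 11.14; Browder,
*Surgery on simply-connected manifolds* (1972), III.1):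

* a closed-manifold structure `[ChartedSpace (EuclideanSpace ℝ (Fin (n+1))) Ŵ]` on the closed
  model `Ŵ = W ∪ cone(∂W)` (the tree's named fact `nonempty_chartedSpace_closedModel`, Kosinski
  X (3.3) with VIII.4.6), and
* a **closed tube** `t : W × [0,1]ᴺ ↪ 𝕊ⁿ⁺¹⁺ᴺ` of `W` in a sphere whose open part
  `t (W° × (0,1)ᴺ)` is open (a framed embedding, which a `π`-manifold has by Whitney's theorem and
  the stable parallelizability),

with **no connectivity hypothesis** (`isEven_intersectionForm_of_tube`). The proof, entirely in
proved tree files: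

1. (`ℤ → ℤ/2`) For `a ∈ H²ᵐ(Ŵ; ℤ)`, `⟨a ⌣ a, [Ŵ]⟩` is even as soon as the mod-2 reduction of
   `a ⌣ a` vanishes (`CohomologyRingChange.lean`: the reduction is multiplicative and its kernel is
   `2H`).
2. (`Sq`) The reduction `ā ⌣ ā = Sq²ᵐ ā` (`SteenrodSquares.lean`).
3. (collapse) Let `g : 𝕊ⁿ⁺¹⁺ᴺ → Sᴺ Ŵ` be the collapse map of the tube onto the `N`-fold
   suspension (`TubeCollapse.lean`); `g^*` is nonzero on `Hⁿ⁺¹⁺ᴺ` (`TubeCollapseCohomology.lean`: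
   excision and `Hⁿ⁺¹⁺ᴺ(𝕊 ∖ pt) = 0`, `Hⁿ⁺¹⁺ᴺ(𝕊; ℤ/2) ≠ 0`), and `Σᴺ : Hⁿ⁺¹(Ŵ) ≅ Hⁿ⁺¹⁺ᴺ(Sᴺ Ŵ)`
   (`IteratedSuspensionIsomorphism.lean`), so `T = g^* ∘ Σᴺ : Hⁿ⁺¹(Ŵ; ℤ/2) → Hⁿ⁺¹⁺ᴺ(𝕊; ℤ/2)` is
   nonzero.
4. (closed manifold) `Hⁿ⁺¹(Ŵ; ℤ/2)` has a single nonzero element `v₀` (`Hₙ₊₁(Ŵ; ℤ/2) ≅ ℤ/2`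
   for the connected closed `Ŵ`, `FundamentalClassExistence.lean`, `OrientationProofs.lean`, and
   universal coefficients over the field `ℤ/2`), hence `T v₀ ≠ 0`.
5. (stability of `Sq`) `T (Sq²ᵐ ȳ) = Sq²ᵐ (g^* Σᴺ ȳ)` with `g^* Σᴺ ȳ ∈ H²ᵐ⁺ᴺ(𝕊; ℤ/2) = 0`
   (`2m + N ∉ {0, n+1+N}`), so `Sq²ᵐ ȳ ≠ v₀`, i.e. `Sq²ᵐ ȳ = 0` — the Wu class vanishes.

Everything here is proved; no named facts are introduced. The tube is produced from
`IsStablyParallelizable` in the sequel (Pontryagin–Thom for manifolds with boundary).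

## References

* A. Kosinski, *Differential Manifolds*, Academic Press 1993, Ch. X Prop. (3.1) p. 205.
  [Kosinski1993]
* J. Milnor, J. Stasheff, *Characteristic classes*, Princeton UP 1974, §18 (Pontryagin–Thom
  collapse), Thm. 11.14 (Wu's formula). [MilnorStasheff1974]
* A. Hatcher, *Algebraic Topology*, CUP 2002, §4.L (Steenrod squares), §3.3 (duality). [Hatcher2002]
-/

noncomputable section

open scoped Manifold ContDiff
open Set Function CategoryTheory CategoryTheory.Limits unitInterval
open Literature.AlgebraicTopology.SingularHomology Literature.AlgebraicTopology.Homotopy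

universe u

namespace Literature.Topology.FourManifolds

/-- Local notation for the unit sphere `𝕊ᵏ ⊆ ℝᵏ⁺¹` (a set, used as a type). -/
local notation "𝕊 " k:arg => (Metric.sphere (0 : EuclideanSpace ℝ (Fin (k + 1))) 1)

/-! ### Generic lemmas over `ℤ/2` -/

section ModTwo

variable {X : Type u} [TopologicalSpace X]

/-- **If `H_d(X; ℤ/2) ≅ ℤ/2` then `Hᵈ(X; ℤ/2)` has at most one nonzero element**: by universal
coefficients over the field `ℤ/2` (`kroneckerPairing_bijective_of_field`) a class is determined
by its Kronecker pairing with the two homology classes `0`, `c₀`. [cite: Hatcher2002, §3.1 Thm. 3.2] -/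
theorem eq_of_ne_zero_of_top_iso {d : ℕ}
    (e : singularHomology (ZMod 2) (ZMod 2) X d ≅ ModuleCat.of (ZMod 2) (ULift.{u} (ZMod 2)))
    {a b : singularCohomology (ZMod 2) (ZMod 2) X d} (ha : a ≠ 0) (hb : b ≠ 0) : a = b := by
  set c₀ : singularHomology (ZMod 2) (ZMod 2) X d := e.inv ⟨1⟩ with hc₀
  have hc : ∀ c : singularHomology (ZMod 2) (ZMod 2) X d, c = 0 ∨ c = c₀ := by
    intro c
    have hcc : c = e.inv (e.hom c) := by
      rw [← ModuleCat.comp_apply, e.hom_inv_id]; rfl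
    obtain ⟨r, hr⟩ : ∃ r : ZMod 2, e.hom c = ⟨r⟩ := ⟨(e.hom c).down, rfl⟩
    fin_cases r
    · left
      rw [hcc, hr]
      exact map_zero (ConcreteCategory.hom e.inv)
    · right
      rw [hcc, hr, hc₀]
      rfl
  have hinj := (kroneckerPairing_bijective_of_field (ZMod 2) X d).1
  have key : ∀ a : singularCohomology (ZMod 2) (ZMod 2) X d, a ≠ 0 →
      kroneckerPairing (ZMod 2) (ZMod 2) X d a c₀ = 1 := by
    intro a ha
    by_contra h1
    have h0 : kroneckerPairing (ZMod 2) (ZMod 2) X d a c₀ = 0 := by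
      generalize hv : kroneckerPairing (ZMod 2) (ZMod 2) X d a c₀ = v
      rw [hv] at h1
      fin_cases v
      · rfl
      · exact absurd rfl h1
    apply ha
    apply hinj
    refine LinearMap.ext fun c => ?_
    rw [map_zero, LinearMap.zero_apply]
    rcases hc c with rfl | rfl
    · rw [map_zero]
    · exact h0
  apply hinj
  refine LinearMap.ext fun c => ?_
  rcases hc c with rfl | rfl
  · rw [map_zero, map_zero]
  · rw [key a ha, key b hb]

/-- `Hᴹ(𝕊ᴹ; ℤ/2) ≠ 0` for `M ≥ 1` (`H_M(𝕊ᴹ) ≅ ℤ/2` and universal coefficients).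
[cite: Hatcher2002, Cor. 2.14 and Thm. 3.2] -/
theorem not_isZero_singularCohomology_sphere_top {M : ℕ} (hM : 1 ≤ M) :
    ¬ IsZero (singularCohomology (ZMod 2) (ZMod 2) (𝕊 M) M) := by
  intro hZ
  obtain ⟨e⟩ := nonempty_singularHomology_sphere_iso_holds (R := ZMod 2) (M := ZMod 2) hM
  let φ : singularHomology (ZMod 2) (ZMod 2) (𝕊 M) M →ₗ[ZMod 2] ZMod 2 :=
    (ULift.moduleEquiv : ULift.{0} (ZMod 2) ≃ₗ[ZMod 2] ZMod 2).toLinearMap ∘ₗ e.hom.hom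
  obtain ⟨u, hu⟩ := (kroneckerPairing_bijective_of_field (ZMod 2) (𝕊 M) M).2 φ
  haveI := ModuleCat.subsingleton_of_isZero hZ
  have hu0 : u = 0 := Subsingleton.elim u 0
  have h1 : φ (e.inv ⟨1⟩) = 1 := by
    change (ULift.moduleEquiv : ULift.{0} (ZMod 2) ≃ₗ[ZMod 2] ZMod 2) (e.hom (e.inv ⟨1⟩)) = 1
    rw [← ModuleCat.comp_apply, e.inv_hom_id]; rfl
  rw [← hu, hu0, map_zero, LinearMap.zero_apply] at h1
  exact zero_ne_one h1

/-- `Hᵏ(𝕊ᴹ; ℤ/2) = 0` for `k ≠ 0, M` (`H_k(𝕊ᴹ) = 0` and universal coefficients).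
[cite: Hatcher2002, Cor. 2.14 and Thm. 3.2] -/
theorem isZero_singularCohomology_sphere {M k : ℕ} (hk0 : k ≠ 0) (hkM : k ≠ M) :
    IsZero (singularCohomology (ZMod 2) (ZMod 2) (𝕊 M) k) := by
  have hZ := isZero_singularHomology_sphere_holds (R := ZMod 2) (M := ZMod 2) hk0 hkM
  haveI := ModuleCat.subsingleton_of_isZero hZ
  haveI : Subsingleton (singularCohomology (ZMod 2) (ZMod 2) (𝕊 M) k) := ⟨fun a b =>
    (kroneckerPairing_bijective_of_field (ZMod 2) (𝕊 M) k).1 (LinearMap.ext fun c => by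
      rw [Subsingleton.elim c 0, map_zero, map_zero])⟩
  exact ModuleCat.isZero_of_subsingleton _

/-- `Hᴹ(𝕊ᴹ ∖ {s}; ℤ/2) = 0` for `M ≠ 0` (a punctured sphere is contractible). [cite: Hatcher2002, §3.1 p. 201] -/
theorem isZero_singularCohomology_sphere_compl_singleton {M : ℕ} (hM : M ≠ 0) (s : 𝕊 M) :
    IsZero (singularCohomology (ZMod 2) (ZMod 2) ({s}ᶜ : Set (𝕊 M)) M) := by
  haveI := contractibleSpace_sphere_compl_singleton s
  exact isZero_singularCohomology_of_contractibleSpace (ZMod 2) (ZMod 2) _ hM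

/-- `Sq₀ x = x ⌣ x` in the lower indexing with explicit output degree: for `x ∈ Hᵖ` and
`p + p = n`, `steenrodSqLower X p n 0 x = cupProduct h x x` (Steenrod 1947, §6; the tree's
`steenrodSq_self`). [cite: Steenrod1947, §6] -/
theorem steenrodSqLower_zero_eq_cupProduct {p n : ℕ} (h : p + p = n)
    (x : singularCohomology (ZMod 2) (ZMod 2) X p) :
    steenrodSqLower X p n 0 x = cupProduct h x x := by
  subst h
  have := steenrodSq_self x
  rwa [show steenrodSq X p p = steenrodSqLower X p (p + p) 0 by
    rw [show (0 : ℕ) = p - p from (Nat.sub_self p).symm]] at this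

end ModTwo

/-! ### The evenness theorem -/

section Assembly

variable {n m : ℕ}

/-- **Evenness of the intersection form from a tube and a closed-manifold structure on the
closed model** (Kosinski 1993, X (3.1) p. 205, evenness half, by the Wu-class route of
Milnor–Stasheff §18 / Thm. 11.14): for `n + 1 = 4m`, a homotopy `n`-sphere `Σ`, a
null-cobordism `c` of `Σ` with simply connected `W = c.W`, any `ℤ`-orientation `μ'` of the closed
model `Ŵ` carrying a closed-manifold atlas, and a closed tube `t : W × [0,1]ᴺ ↪ 𝕊ⁿ⁺¹⁺ᴺ`
(continuous, injective) whose open part over the interior is open, the intersection form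
`Q(a, b) = ⟨a ⌣ b, [Ŵ]⟩` on `H²ᵐ(Ŵ; ℤ)/T` is even. See the module docstring for the proof.
[cite: Kosinski1993, Ch. X, Prop. (3.1) (p. 205)] -/
theorem isEven_intersectionForm_of_tube (hnm : n + 1 = 4 * m) (S : HomotopySphere n)
    (c : NullCobordism n S.carrier)
    [ChartedSpace (EuclideanSpace ℝ (Fin (n + 1))) (ClosedModel n c.W)]
    (μ' : HomologicalOrientation ℤ (ClosedModel n c.W) (n + 1)) (hsc : SimplyConnectedSpace c.W)
    {N M : ℕ} (hM : M = n + 1 + N) (t : c.W × (Fin N → I) → 𝕊 M) (ht : Continuous t)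
    (hinj : Injective t)
    (hTo : IsOpen (tubeCollapse.openTube ((𝓡∂ (n + 1)).interior c.W) t)) :
    (intersectionForm (show 2 * m + 2 * m = n + 1 by omega) μ').IsEven := by
  subst hM
  -- the interior, the closed model and its basic instances
  set X : Set c.W := (𝓡∂ (n + 1)).interior c.W with hXdef
  have hX : IsOpen X := (𝓡∂ (n + 1)).isOpen_interior (M := c.W) one_ne_zero
  haveI : Nonempty (ClosedModel n c.W) := ⟨ClosedModel.infty⟩
  haveI : Fact (Nat.Prime 2) := ⟨Nat.prime_two⟩
  haveI : NeZero (n + 1) := ⟨Nat.succ_ne_zero n⟩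
  haveI : NeZero (2 * m) := ⟨by omega⟩
  haveI := hsc
  -- the closed model is connected (`W` path connected, boundary nonempty)
  haveI : PathConnectedSpace (𝕊 n) := pathConnectedSpace_sphere (n := n) (by omega)
  obtain ⟨eS⟩ := S.nonempty_homotopyEquiv
  have hbd : ((𝓡∂ (n + 1)).boundary c.W).Nonempty :=
    ⟨c.incl (eS.invFun (Classical.arbitrary _)), c.incl_mem_boundary _⟩
  haveI : ConnectedSpace (ClosedModel n c.W) := connectedSpace_closedModel hbd
  -- (4) the top `ℤ/2`-cohomology has one nonzero element
  obtain ⟨μ₂⟩ := nonempty_homologicalOrientation_zmod_two (X := ClosedModel n c.W) (n := n + 1)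
  obtain ⟨eTop⟩ := nonempty_singularHomology_top_iso_holds (R := ZMod 2) (X := ClosedModel n c.W)
    (n + 1) μ₂
  have hV : ∀ a b : singularCohomology (ZMod 2) (ZMod 2) (ClosedModel n c.W) (n + 1),
      a ≠ 0 → b ≠ 0 → a = b := fun a b => eq_of_ne_zero_of_top_iso eTop
  -- (3) the collapse map of the tube and the nonzero map `T = g^* ∘ Σᴺ`
  obtain ⟨x₀, hx₀⟩ : X.Nonempty := interior_nonempty
  obtain ⟨τ, hτ⟩ := tubeCollapse.exists_cubeCoord (X := X) ht hinj hTo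
  let g : C(𝕊 (n + 1 + N), suspN (ClosedModel n c.W) N) :=
    ⟨tubeCollapse.map X ht hinj τ, tubeCollapse.continuous_map hX ht hinj hTo hτ⟩
  obtain ⟨y, hy⟩ := tubeCollapse.exists_map_ne_zero (ZMod 2) hX ⟨x₀, hx₀⟩ ht hinj hTo hτ
    (n + 1 + N) (fun s => isZero_singularCohomology_sphere_compl_singleton (by omega) s)
    (not_isZero_singularCohomology_sphere_top (by omega))
  change singularCohomology (ZMod 2) (ZMod 2) (suspN (ClosedModel n c.W) N) (n + 1 + N) at y
  change singularCohomology.map (ZMod 2) (ZMod 2) g (n + 1 + N) y ≠ 0 at hy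
  let Φ := suspensionIsoN (ZMod 2) (ZMod 2) (ClosedModel n c.W) (n + 1) N
  obtain ⟨v₀, rfl⟩ : ∃ v, Φ.hom v = y :=
    ⟨Φ.inv y, by rw [← ModuleCat.comp_apply, Φ.inv_hom_id]; rfl⟩
  have hv₀ : v₀ ≠ 0 := fun h => hy (by rw [h, map_zero, map_zero])
  -- (5) the squares `Sq²ᵐ : H²ᵐ(Ŵ; ℤ/2) → Hⁿ⁺¹(Ŵ; ℤ/2)` vanish
  have hsq : ∀ ybar : singularCohomology (ZMod 2) (ZMod 2) (ClosedModel n c.W) (2 * m),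
      steenrodSqLower (ClosedModel n c.W) (2 * m) (n + 1) 0 ybar = 0 := by
    intro ybar
    by_contra hz
    apply hy
    rw [← hV _ _ hz hv₀, suspensionIsoN_steenrodSqLower (ClosedModel n c.W) (n + 1) 0 ybar N,
      steenrodSqLower_map]
    have h0 : singularCohomology.map (ZMod 2) (ZMod 2) g (2 * m + N)
        ((suspensionIsoN (ZMod 2) (ZMod 2) (ClosedModel n c.W) (2 * m) N).hom ybar) = 0 := by
      haveI := ModuleCat.subsingleton_of_isZero
        (isZero_singularCohomology_sphere (M := n + 1 + N) (k := 2 * m + N) (by omega) (by omega))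
      exact Subsingleton.elim _ _
    rw [h0, map_zero]
  -- (1)+(2) evenness of `⟨a ⌣ a, [Ŵ]⟩`
  intro xq
  obtain ⟨a, rfl⟩ := freeCohomology.mk_surjective xq
  rw [intersectionForm_mk_mk, cupPairing_apply]
  have hρ : singularCohomology.ringChange (Int.castRingHom (ZMod 2)) (ClosedModel n c.W) (n + 1)
      (cupProduct (show 2 * m + 2 * m = n + 1 by omega) a a) = 0 := by
    rw [singularCohomology.ringChange_cupProduct, ← steenrodSqLower_zero_eq_cupProduct]
    exact hsq _
  obtain ⟨yy, hyy⟩ := exists_eq_add_self_of_ringChange_eq_zero _ hρ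
  rw [hyy, map_add, LinearMap.add_apply]
  exact ⟨_, rfl⟩

end Assembly

end Literature.Topology.FourManifolds
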